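import Summits.BirchSwinnertonDyer.BirchSwinnertonDyer.Theorems.PrintCFramBottomClassIndexLawFiveLeBernoulliUnitsAvatars
import Literature.NumberTheory.NumberFields.HerbrandStickelbergerDictionary
import HarnessLib

/-!
# Route `PrintCFram`, crux C2 `BottomClassIndexLawFiveLe` (stmt-BirchSwinnertonDyer-20372), line
# `eisenstein-resource-bdp-line` (registry v19; LEAD g10 report §2(d)(β), §4 `classFactor_imp_levelPos_or_sha`):
# **AVATAR BOOKKEEPING FOR THE (β) CONSUMER** — the class's odd Kriz–Li character `ψ` IS the Dirichlet avatar
# of the sub character `θ_S` (ALIGNED) or of the quotient character `θ_Q` (TRANSVERSE) of the rational line,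
# and an avatar of a character differing from `χ̄_p` somewhere is NOT Teichmüller-congruent
# (cell `bsd-print-cfram`, width seat `bsd-line-cfram-p1-w5` g3; helper `--supports` 20372; 0 defs, 0 facts,
# 0 sorry)

HONEST FRAMING. Nothing about BSD is proved here, and nothing of any stub. w6 g3's
`LevelDictionaryRationalLine.exists_rationalLineData_of_hss` (p672xxx) returns, for a class member and ANY
`(f, ψ, ω)` with the trace form, the rational line `Φ` with characters `θ_S = b ∘ χ_m`, `θ_Q = χ̄_p · (b ∘ χ_m)⁻¹`,
the Teichmüller lift `ψ₁` (`ψ₁(u) = Teich(b u)`) and the dichotomy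
`ψ↑ = ψ₁↑ ∨ ψ↑ = ψ₁⁻¹↑·ω↑` (level `f·m·p`). The (β) source (w5 g3 `…LevelDictionaryBetaSource`,
`exists_equivariantHom_of_odd_avatar_of_norm_bernoulli_lt_one`) wants an avatar `λ` of the character `θ` acting
on the module, in the shape `λ(χ_n τ) = Teich(θ τ)`, ODD, NOT Teichmüller-congruent. Here:

* §1 **`apply_modNCyclotomicCharacter_eq_teich_sub`** — in the first case `ψ(χ_f τ) = Teich(θ_S τ)` (w3's
  `BernoulliUnits.avatar_level_of_lift_psi`); **`apply_modNCyclotomicCharacter_eq_teich_quot`** — in the second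
  case `ψ(χ_f τ) = Teich(θ_Q τ)` (`Teich(χ̄_p τ) = ω(χ_p τ)` for a Teichmüller `ω`, w3's
  `BernoulliUnits.coe_teichmullerChar_eq_apply`). So in BOTH cases `λ = ψ` itself, for `θ = θ_S` resp. `θ_Q`.
* §2 `toZMod_eq_natCast_of_norm_sub_lt_one` (`‖x − a‖_p < 1 ⟹ x ≡ a`), and
  **`not_teichmullerCongruent_of_exists_apply_ne`** — if `λ(χ_n τ) = Teich(θ τ)` for all `τ`, `λ` odd (`p` odd), and
  `θ g ≠ χ̄_p g` for SOME `g ∈ Γ_ℚ` (on the class: the inertia homothety at `p`, w6 g3's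
  `LevelDictionaryAlpha.exists_mem_decompositionSubgroup_apply_ne_cyclotomic_at_p`), then the primitive character
  `λ̃` is NOT Teichmüller-congruent: `¬ ∀ a, p ∤ a → ‖λ̃(a) − a‖_p < 1` — the hypothesis `hlamω` / `hχω` of the
  (β) source and of w6 g2's `exists_absGaloisHom_ne_one_of_norm_bernoulli_lt_one`, DISCHARGED (w5 g2's
  `HerbrandStickelberger.not_forall_norm_sub_lt_one_of_not_and` reduces it to «conductor `= p` and congruent»,
  and then `θ = χ̄_p` everywhere).

THEOREMS ONLY; no definition, no named fact, no `sorry`. BSD is not proved by any of this; no summit statement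
is proved by this seat. References: [Washington1997] §5.1 (the Teichmüller character), Thm. 14.1;
[Solomon1990] §I p. 468 («χ ≠ ω»); [Lang1990] Ch. 1 §3 Lemma 1; the LEAD g10 report §2(d), §4.
-/

set_option autoImplicit false
-- `…BirchSwinnertonDyer.BirchSwinnertonDyer.Theorems…` is the problem's mandated namespace (D-0017).
set_option linter.dupNamespace false

noncomputable section

open scoped Classical

namespace Summit.BirchSwinnertonDyer.BirchSwinnertonDyer.Theorems.PrintCFram.LevelDictionaryBeta

open Field DirichletCharacter Literature.NumberTheory.EllipticCurves.KrizLi2019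
  Literature.NumberTheory.EllipticCurves Literature.NumberTheory.GaloisRepresentations
  Literature.NumberTheory.NumberFields
open Summit.BirchSwinnertonDyer.BirchSwinnertonDyer.Theorems.PrintCFram.BernoulliUnits

variable {p : ℕ} [hp : Fact p.Prime]

/-! ## §1 `ψ` is the avatar of `θ_S` (aligned) or of `θ_Q` (transverse) -/

section Avatar

variable {f m : ℕ} [NeZero f] [NeZero m] {M : ℕ} [NeZero M]

/-- **ALIGNED: `ψ(χ_f τ) = Teich(θ_S τ)`.** If `θ_S = b ∘ χ_m`, `ψ₁(u) = Teich(b u)` and `ψ↑ = ψ₁↑` at a common level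
`M`, then `ψ` is the avatar of `θ_S` in the engines' shape. [cite: Washington1997, §5.1] -/
theorem apply_modNCyclotomicCharacter_eq_teich_sub (b : (ZMod m)ˣ →* (ZMod p)ˣ) {ψ₁ : DirichletCharacter ℚ_[p] m}
    (hψ₁ : ∀ u : (ZMod m)ˣ, ψ₁ (u : ZMod m) = (((Kato2004.teichmullerChar p (b u) : ℤ_[p]ˣ) : ℤ_[p]) : ℚ_[p]))
    (θS : absoluteGaloisGroup ℚ →* (ZMod p)ˣ)
    (hθS : ∀ τ : absoluteGaloisGroup ℚ, θS τ = b (modNCyclotomicCharacter ℚ m τ))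
    (hf : f ∣ M) (hm : m ∣ M) (ψ : DirichletCharacter ℚ_[p] f) (el : changeLevel hf ψ = changeLevel hm ψ₁)
    (τ : absoluteGaloisGroup ℚ) :
    ψ ((modNCyclotomicCharacter ℚ f τ : (ZMod f)ˣ) : ZMod f) =
      (((Kato2004.teichmullerChar p (θS τ) : ℤ_[p]ˣ) : ℤ_[p]) : ℚ_[p]) := by
  rw [hθS]
  exact (avatar_level_of_lift_psi b hψ₁ hf hm ψ el τ).symm

/-- **TRANSVERSE: `ψ(χ_f τ) = Teich(θ_Q τ)`.** If `θ_Q = χ̄_p · (b ∘ χ_m)⁻¹`, `ψ₁(u) = Teich(b u)`, `ω` is Teichmüller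
(`p` odd) and `ψ↑ = ψ₁⁻¹↑ · ω↑` at a common level `M`, then `ψ` is the avatar of `θ_Q` in the engines' shape
(`ω(χ_p τ) = Teich(χ̄_p τ)`, `BernoulliUnits.coe_teichmullerChar_eq_apply`). [cite: Washington1997, §5.1] -/
theorem apply_modNCyclotomicCharacter_eq_teich_quot (hp2 : p ≠ 2) (b : (ZMod m)ˣ →* (ZMod p)ˣ)
    {ψ₁ : DirichletCharacter ℚ_[p] m}
    (hψ₁ : ∀ u : (ZMod m)ˣ, ψ₁ (u : ZMod m) = (((Kato2004.teichmullerChar p (b u) : ℤ_[p]ˣ) : ℤ_[p]) : ℚ_[p]))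
    {ω : DirichletCharacter ℚ_[p] p} (hω : IsTeichmullerCharacter ω)
    (θQ : absoluteGaloisGroup ℚ →* (ZMod p)ˣ)
    (hθQ : ∀ τ : absoluteGaloisGroup ℚ,
      θQ τ = modNCyclotomicCharacter ℚ p τ * (b (modNCyclotomicCharacter ℚ m τ))⁻¹)
    (hf : f ∣ M) (hm : m ∣ M) (hpM : p ∣ M) (ψ : DirichletCharacter ℚ_[p] f)
    (el : changeLevel hf ψ = changeLevel hm ψ₁⁻¹ * changeLevel hpM ω) (τ : absoluteGaloisGroup ℚ) :
    ψ ((modNCyclotomicCharacter ℚ f τ : (ZMod f)ˣ) : ZMod f) =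
      (((Kato2004.teichmullerChar p (θQ τ) : ℤ_[p]ˣ) : ℤ_[p]) : ℚ_[p]) := by
  rw [← changeLevel_apply_modNCyclotomicCharacter hf ψ τ, el, MulChar.mul_apply,
    changeLevel_apply_modNCyclotomicCharacter, changeLevel_apply_modNCyclotomicCharacter, MulChar.inv_apply_eq_inv',
    hψ₁, ← coe_teichmullerChar_eq_apply hp2 hω, hθQ, coe_teichmullerChar_mul, coe_teichmullerChar_inv, mul_comm]

end Avatar

/-! ## §2 An avatar of a character `≠ χ̄_p` somewhere is not Teichmüller-congruent -/

section Teichmuller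

/-- `‖x − a‖_p < 1` for `x ∈ ℤ_p` and a natural number `a` gives `x ≡ a (mod p)`. [folklore] -/
theorem toZMod_eq_natCast_of_norm_sub_lt_one {x : ℤ_[p]} {a : ℕ} (h : ‖(x : ℚ_[p]) - (a : ℚ_[p])‖ < 1) :
    PadicInt.toZMod x = (a : ZMod p) := by
  have hlt : ‖x - (a : ℤ_[p])‖ < 1 := by
    rw [PadicInt.norm_def, PadicInt.coe_sub]
    push_cast
    exact h
  have hmem : x - (a : ℤ_[p]) ∈ RingHom.ker (PadicInt.toZMod : ℤ_[p] →+* ZMod p) := by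
    rw [PadicInt.ker_toZMod, IsLocalRing.mem_maximalIdeal, mem_nonunits_iff, PadicInt.isUnit_iff]
    exact ne_of_lt hlt
  rw [RingHom.mem_ker, map_sub, map_natCast, sub_eq_zero] at hmem
  exact hmem

variable {n : ℕ} [NeZero n]

/-- **AN AVATAR OF A CHARACTER DIFFERING FROM `χ̄_p` IS NOT TEICHMÜLLER-CONGRUENT.** `p` odd; `λ` a Dirichlet character of
level `n` with values in `ℚ_p`, ODD, with `λ(χ_n τ) = Teich(θ τ)` for all `τ ∈ Γ_ℚ` (the engines' avatar shape) for a character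
`θ : Γ_ℚ →* 𝔽_pˣ`; if `θ g ≠ χ̄_p g` for SOME `g`, then the primitive character `λ̃` is NOT congruent to the Teichmüller
character: `¬ ∀ a ∈ ℤ, p ∤ a → ‖λ̃(a) − a‖_p < 1`. (By w5 g2's `not_forall_norm_sub_lt_one_of_not_and` it suffices to refute
«`cond λ = p` and congruent»; then `p ∣ cond λ`, and at `a = χ_{cond}(g)` the congruence reads `Teich(θ g) ≡ χ̄_p(g)`, i.e.
`θ g = χ̄_p g`.) This DISCHARGES the hypothesis `hlamω` of the (β) source / `hχω` of w6 g2's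
`exists_absGaloisHom_ne_one_of_norm_bernoulli_lt_one` on the class, where the inertia homothety at `p` supplies `g`.
[cite: Solomon1990, §I p. 468] [cite: Lang1990, Ch. 1 §3 Lemma 1] [cite: Washington1997, §5.1] -/
theorem not_teichmullerCongruent_of_exists_apply_ne (hp2 : p ≠ 2) (lam : DirichletCharacter ℚ_[p] n)
    (θ : absoluteGaloisGroup ℚ →* (ZMod p)ˣ)
    (hlam : ∀ τ : absoluteGaloisGroup ℚ, lam ((modNCyclotomicCharacter ℚ n τ : (ZMod n)ˣ) : ZMod n) =
      (((Kato2004.teichmullerChar p (θ τ) : ℤ_[p]ˣ) : ℤ_[p]) : ℚ_[p]))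
    (hodd : lam.Odd) (hne : ∃ g : absoluteGaloisGroup ℚ, θ g ≠ modNCyclotomicCharacter ℚ p g) :
    ¬ ∀ a : ℤ, ¬ ((p : ℤ) ∣ a) →
      ‖lam.primitiveCharacter (a : ZMod lam.conductor) - (a : ℚ_[p])‖ < 1 := by
  haveI : NeZero lam.conductor := ⟨lam.conductor_ne_zero⟩
  have hdvd := lam.conductor_dvd_level
  have hprim : lam.primitiveCharacter.IsPrimitive := primitiveCharacter_isPrimitive lam
  -- `λ̃` is odd
  have hψχ : ∀ u : (ZMod n)ˣ, lam (u : ZMod n) =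
      lam.primitiveCharacter ((ZMod.unitsMap hdvd u : (ZMod lam.conductor)ˣ) : ZMod lam.conductor) := fun u => by
    conv_lhs => rw [← changeLevel_primitiveCharacter lam]
    rw [changeLevel_eq_cast_of_dvd _ hdvd, ZMod.unitsMap_def, Units.coe_map, MonoidHom.coe_coe, ZMod.castHom_apply]
  have hodd' : lam.primitiveCharacter.Odd := by
    have h := hψχ (-1)
    rw [ZMod.unitsMap_def, Units.map_neg_one, Units.val_neg, Units.val_one, Units.val_neg, Units.val_one] at h
    rw [DirichletCharacter.Odd, ← h]
    exact hodd
  refine HerbrandStickelberger.not_forall_norm_sub_lt_one_of_not_and hp2 hprim hodd' ?_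
  rintro ⟨hc, hT⟩
  obtain ⟨g, hg⟩ := hne
  have hpc : p ∣ lam.conductor := ⟨1, by rw [hc, mul_one]⟩
  -- `a = χ_{cond}(g)` read as a natural number
  set u : (ZMod lam.conductor)ˣ := modNCyclotomicCharacter ℚ lam.conductor g with hu
  have hpa : ¬ ((p : ℤ) ∣ (((u : ZMod lam.conductor).val : ℕ) : ℤ)) := by
    intro h
    have hcop := ZMod.val_coe_unit_coprime u
    have hpdvd : p ∣ (u : ZMod lam.conductor).val := by exact_mod_cast h
    have : p ∣ Nat.gcd (u : ZMod lam.conductor).val lam.conductor := Nat.dvd_gcd hpdvd hpc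
    rw [hcop] at this
    exact hp.out.one_lt.ne' (Nat.dvd_one.mp this)
  have h1 := hT _ hpa
  -- `λ̃(a) = λ(χ_n g) = Teich(θ g)`
  have hχa : lam.primitiveCharacter (((((u : ZMod lam.conductor).val : ℕ) : ℤ) : ZMod lam.conductor)) =
      (((Kato2004.teichmullerChar p (θ g) : ℤ_[p]ˣ) : ℤ_[p]) : ℚ_[p]) := by
    rw [Int.cast_natCast, ZMod.natCast_zmod_val, hu, primitiveCharacter_apply_modNCyclotomicCharacter, hlam]
  rw [hχa] at h1
  push_cast at h1
  -- hence `θ g = χ̄_p g`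
  have hred : ((θ g : (ZMod p)ˣ) : ZMod p) = (((u : ZMod lam.conductor).val : ℕ) : ZMod p) := by
    rw [← Kato2004.toZMod_teichmullerChar]
    exact toZMod_eq_natCast_of_norm_sub_lt_one h1
  have hχp : ((modNCyclotomicCharacter ℚ p g : (ZMod p)ˣ) : ZMod p) = (((u : ZMod lam.conductor).val : ℕ) : ZMod p) := by
    rw [← unitsMap_modNCyclotomicCharacter_of_dvd ℚ hpc g, ZMod.unitsMap_val, hu, ZMod.cast_eq_val]
  exact hg (Units.ext (hred.trans hχp.symm))

end Teichmuller

end Summit.BirchSwinnertonDyer.BirchSwinnertonDyer.Theorems.PrintCFram.LevelDictionaryBeta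

end
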